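import Summits.Ventures.HodgeKum4.Theorems.LaneVDefs
import Summits.Ventures.HodgeKum4.Theorems.KummerFixedLocusLefschetzTransfer
import Literature.AlgebraicGeometry.Hyperkaehler.LefschetzClassesIrreducibleSymplectic
import Literature.AlgebraicGeometry.Hyperkaehler.IrreducibleSymplecticOfDeformationType
import Literature.AlgebraicGeometry.HilbertScheme.HilbertSchemeTranslationAction
import Literature.AlgebraicGeometry.HilbertScheme.TranslationActionCohomology
import Literature.AlgebraicGeometry.HilbertScheme.PoincareCasimirElement
import Literature.AlgebraicGeometry.HodgeTheory.DualLefschetzInLefschetzInvolutionAlgebraHolds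
import Literature.AlgebraicGeometry.HodgeTheory.GysinBaseChange
import Literature.AlgebraicGeometry.Motives.AbelianVarietyProjectiveChart
import Literature.AlgebraicGeometry.Motives.VarietiesUnitProofs
import Literature.AlgebraicGeometry.Surfaces.K3LatticeInvariantsProofs
import Literature.AlgebraicTopology.SingularHomology.FiniteQuotientInvariants
import Literature.AlgebraicTopology.SingularHomology.KroneckerDegreeOne
import HarnessLib

/-!
# Seam S3 of line `laneV` (crux `LefschetzGenerationKum4`, `stmt-Ventures-19134`): the restriction `θ*D_α` of the
divisor class of a polarization to the generalized Kummer fibre has a dual Lefschetz operator — PROVED modulo print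

Cell `hodge-kum4` (ladder HodgeAV rung H3), lane (V).  The line `Cruxes/LefschetzGenerationKum4/Lines/laneV.lean`
registers the seam
`KummerDivisorClassLefschetz : ∀ n ≥ 1, A (dim 2), K, H : HilbertSchemesOfPoints A.X, 𝔊 : ChernCharacterOperators,
Kummer fibre j : K ⟶ A^[n+1] (K smooth projective of dim 2n), α polarization of A ⟹
HasDualLefschetz (2n) (θ*(𝔊.divisorClass (n+1) α))`.
This file proves it from three REFEREED print facts (and nothing else):

* `Hyperkaehler.Beauville1983_irreducibleSymplectic_of_kummerType` (Beauville 1983 §7 Thm. 4: `Kⁿ(A)` is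
  irreducible symplectic — gives `b₁(K) = 0` and feeds the criterion below) — already in the line's print bundle;
* `HilbertScheme.Beauville1983_kummerCover_galois` (Beauville §7 footnote 2 / Kapfer–Menet Lemma 5.4: Beauville's
  cover `Θ : A × K → A^[n+1]`, `(a, ξ) ↦ t_a(j ξ)`, is a finite Galois cover) — F6, the input of V0;
* `Hyperkaehler.Verbitsky1996_hasDualLefschetz_of_topPower_ne_zero` (Verbitsky / Looijenga–Lunts / Fujiki: on an
  irreducible symplectic `2n`-fold a class `β ∈ H²` with `β^{2n} ≠ 0` has a dual Lefschetz operator).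

## The argument (`S3 = D3 ∘ T`, instance-invariant)

D3 = `HilbertScheme.ChernCharacterOperators.isDualLefschetz_transferOp` (PROVED in the tree, for EVERY instance
`𝔊` of the Li–Qin–Wang interface): `D_α = 𝔊.divisorClass (n+1) α` IS a Lefschetz class on `H*(A^[n+1](ℂ); ℂ)`
(an `𝔰𝔩₂`-triple with the transferred dual of `Λ_α`).  T = **`hasDualLefschetz_map_kummerFibre`** (this file):
for ANY class `ℓ ∈ H²(H(ℂ); ℂ)` of ANY Hilbert-scheme model `(H, Ξ)` of `n+1` points of the abelian surface `A`
with a Kummer fibre `j : K ⟶ H`: `ℓ` Lefschetz on `H` ⟹ `θ*ℓ = j(ℂ)^*ℓ` Lefschetz on `K`.  Proof of T: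
`ℓ^{2n+2} ≠ 0` (hard Lefschetz in degree 0, `cupPowTwo_ne_zero_of_isDualLefschetz`); pull back along
`Θ = kummerCover act j` (`act` THE translation action, `HilbertScheme.translationAction`, PROVED to exist):
`Θ(ℂ)^*` is injective (the Galois-cover fact + transfer, `FiniteDeckCover.map_proj_injective`), and by Künneth in
degree 2 (`kunnethSpan_complexBetti`) with `H¹(K(ℂ); ℂ) = 0` (simply connected) and `H⁰ = ℂ·1` on both factors,
`Θ(ℂ)^*ℓ = pr_A^* a + pr_K^* b`; since `a³ = 0` (`H⁶(A(ℂ)) = 0`) the topological core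
(`KummerFixedLocusLefschetzTransfer.cupPowTwo_ne_zero_of_add_decomposition`) gives `b^{2n} ≠ 0`; and `b = θ*ℓ`
because the section `ι = (e, id) : K → A × K` has `pr_K ∘ ι = id`, `pr_A ∘ ι` constant, and `Θ ∘ ι = t_e ∘ j = j`
(`IsTranslationAction.translateHilb_one`).  Finally `K` is irreducible symplectic (Beauville), so the criterion applies.
No identification of `𝔊.divisorClass` with a geometric class is used anywhere (cf. the instance-dependence caveat on
the bus, 2026-08-27T09:11Z): D3 and T are both statements about every instance / every class.

## Main declarations

* `hasDualLefschetz_map_kummerFibre` — T, for every Hilbert-scheme model (the hypotheses of V0/F6).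
* `hasDualLefschetz_map_divisorClass` — **S3's body**: the registered seam `KummerDivisorClassLefschetz` with its
  binders VERBATIM, from the three facts (the planner folds it into the line as
  `fun hBe hGal hV ↦ fun _ _ _ hA hn hS H 𝔊 𝒜 x₀ j hsq hKs α hα ↦ hasDualLefschetz_map_divisorClass hBe hGal hV …`).

HONEST FRAMING: conditional on the three named print facts (hypotheses); nothing here asserts V0, L1, L1-Hilb(5),
`HC_Kum4Type` or HC.
-/

noncomputable section

open CategoryTheory MonoidalCategory CartesianMonoidalCategory DirectSum
open Literature.AlgebraicTopology.SingularHomology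
open Literature.AlgebraicGeometry Literature.AlgebraicGeometry.Hyperkaehler Literature.AlgebraicGeometry.HilbertScheme
open Literature.AlgebraicGeometry.Motives (SchemeOver ComplexPoints IsSmoothProjective AbelianVariety)
open Literature.AlgebraicGeometry.HodgeTheory (complexBetti cupPowTwo)

namespace Summit.Ventures.HodgeKum4

open scoped MonObj

/-! ### §1 Small facts about the cohomology of a smooth projective variety -/

section SmoothProjective

variable {d : ℕ} {X : SchemeOver ℂ}

/-- `1 ≠ 0` in `H⁰(X(ℂ); ℂ)` for `X` smooth projective (`dim H⁰ = 1`, and `x = x ⌣ 1` for every `x`). -/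
theorem singularCohomology_one_ne_zero_of_isSmoothProjective (hX : IsSmoothProjective d X) :
    singularCohomology.one ℂ (ComplexPoints X) ≠ 0 := by
  intro h
  haveI : Nontrivial (complexBetti X 0) := Module.nontrivial_of_finrank_pos (R := ℂ)
    (by rw [Literature.AlgebraicGeometry.Surfaces.finrank_complexBetti_zero hX]; exact Nat.one_pos)
  obtain ⟨x, hx⟩ := exists_ne (0 : complexBetti X 0)
  exact hx (calc x = cupProduct (Nat.add_zero 0) x (singularCohomology.one ℂ (ComplexPoints X)) :=
      (cupProduct_one x).symm
    _ = 0 := by rw [h, map_zero])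

/-- Every class in `H⁰(X(ℂ); ℂ)` is a multiple of `1`, for `X` smooth projective (`dim H⁰ = 1`, `1 ≠ 0`). -/
theorem exists_eq_smul_one_of_isSmoothProjective (hX : IsSmoothProjective d X) (w : complexBetti X 0) :
    ∃ c : ℂ, w = c • singularCohomology.one ℂ (ComplexPoints X) := by
  obtain ⟨c, hc⟩ := (finrank_eq_one_iff_of_nonzero' _ (singularCohomology_one_ne_zero_of_isSmoothProjective hX)).mp
    (Literature.AlgebraicGeometry.Surfaces.finrank_complexBetti_zero hX) w
  exact ⟨c, hc.symm⟩

/-- `H²(Spec ℂ (ℂ); ℂ) = 0`: pull-backs of degree-two classes through the point vanish. -/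
theorem complexBetti_map_two_eq_zero_of_factors_unit {Y : SchemeOver ℂ} (f : X ⟶ 𝟙_ (SchemeOver ℂ))
    (g : 𝟙_ (SchemeOver ℂ) ⟶ Y) (y : complexBetti Y 2) : complexBetti.map (f ≫ g) 2 y = 0 := by
  haveI : Subsingleton (complexBetti (𝟙_ (SchemeOver ℂ)) 2) :=
    ComplexPoints.subsingleton_singularCohomology_of_lt (Motives.isSmoothProjective_unit_holds ℂ) ℂ (k := 2)
      (by omega)
  rw [HodgeTheory.complexBetti.map_comp, ModuleCat.comp_apply, Subsingleton.elim (complexBetti.map g 2 y) 0, map_zero]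

/-- A Lefschetz class has non-zero top power: `(L_ℓ, h, Λ)` an `𝔰𝔩₂`-triple on `H*(X(ℂ); ℂ)` in dimension `d`
(`X` smooth projective of dimension `d`) ⟹ `ℓ^d ≠ 0`. -/
theorem cupPowTwo_ne_zero_of_isDualLefschetz_complexPoints (hX : IsSmoothProjective d X) {ℓ : complexBetti X 2}
    {Λ : Module.End ℂ (totalCohomology ℂ (ComplexPoints X))} (hℓ : IsDualLefschetz d ℓ Λ) : cupPowTwo ℓ d ≠ 0 := by
  haveI := finite_totalCohomology hX
  exact cupPowTwo_ne_zero_of_isDualLefschetz hℓ (singularCohomology_one_ne_zero_of_isSmoothProjective hX)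

/-- On an abelian surface every degree-two class has `a³ = 0` (`H⁶(A(ℂ); ℂ) = 0`). -/
theorem cupPowTwo_three_eq_zero_of_surface (hS : IsSmoothProjective 2 X) (a : complexBetti X 2) :
    cupPowTwo a (2 + 1) = 0 := by
  haveI : Subsingleton (complexBetti X (2 * (2 + 1))) :=
    ComplexPoints.subsingleton_singularCohomology_of_lt hS ℂ (k := 2 * (2 + 1)) (by omega)
  exact Subsingleton.elim _ _

end SmoothProjective

/-! ### §2 Künneth in degree two for `A × K` with `H¹(K) = 0` -/

/-- **Degree-two classes on `(Y × Z)(ℂ)` are `pr_Y^* a + pr_Z^* b` when `H¹(Z(ℂ); ℂ) = 0`** (`Y`, `Z` smooth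
projective): by the Künneth spanning theorem `kunnethSpan_complexBetti` every class is a combination of
`pr_Y^* x ⌣ pr_Z^* w` with `deg x + deg w = 2`; the `(1,1)` terms vanish, and `H⁰ = ℂ · 1` on both factors turns the
`(2,0)` and `(0,2)` terms into `pr_Y^* a` and `pr_Z^* b`. -/
theorem exists_eq_map_fst_add_map_snd {m k : ℕ} {Y Z : SchemeOver ℂ} (hY : IsSmoothProjective m Y)
    (hZ : IsSmoothProjective k Z) (h1 : ∀ w : complexBetti Z 1, w = 0) (z : complexBetti (Y ⊗ Z) 2) :
    ∃ (a : complexBetti Y 2) (b : complexBetti Z 2),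
      z = complexBetti.map (fst Y Z) 2 a + complexBetti.map (snd Y Z) 2 b := by
  -- the target submodule `pr_Y^* H²(Y) + pr_Z^* H²(Z)`
  let S : Submodule ℂ (complexBetti (Y ⊗ Z) 2) :=
    LinearMap.range (complexBetti.map (fst Y Z) 2).hom ⊔ LinearMap.range (complexBetti.map (snd Y Z) 2).hom
  suffices hz : z ∈ S by
    obtain ⟨u, hu, v, hv, huv⟩ := Submodule.mem_sup.mp hz
    obtain ⟨a, rfl⟩ := LinearMap.mem_range.mp hu
    obtain ⟨b, rfl⟩ := LinearMap.mem_range.mp hv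
    exact ⟨a, b, huv.symm⟩
  refine (Submodule.span_le.mpr ?_) (HodgeTheory.kunnethSpan_complexBetti hY hZ 2 z)
  rintro _ ⟨i, j, hij, b, w, rfl⟩
  -- `i + j = 2`: the three cases `(0,2)`, `(1,1)`, `(2,0)`
  have hi : i ≤ 2 := by omega
  interval_cases i
  · -- `(0, 2)`: `b = c • 1`, so the product is `c • pr_Z^* w`
    obtain rfl : j = 2 := by omega
    obtain ⟨c, rfl⟩ := exists_eq_smul_one_of_isSmoothProjective hY b
    refine Submodule.mem_sup_right (LinearMap.mem_range.mpr ⟨c • w, ?_⟩)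
    have hone : complexBetti.map (fst Y Z) 0 (singularCohomology.one ℂ (ComplexPoints Y)) =
        singularCohomology.one ℂ (ComplexPoints (Y ⊗ Z)) := singularCohomology.map_one _
    rw [map_smul, map_smul, hone, LinearMap.map_smul₂, one_cupProduct]
  · -- `(1, 1)`: `w = 0`
    obtain rfl : j = 1 := by omega
    rw [h1 w, map_zero, map_zero]
    exact S.zero_mem
  · -- `(2, 0)`: `w = c • 1`, so the product is `c • pr_Y^* b`
    obtain rfl : j = 0 := by omega
    obtain ⟨c, rfl⟩ := exists_eq_smul_one_of_isSmoothProjective hZ w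
    refine Submodule.mem_sup_left (LinearMap.mem_range.mpr ⟨c • b, ?_⟩)
    have hone : complexBetti.map (snd Y Z) 0 (singularCohomology.one ℂ (ComplexPoints Z)) =
        singularCohomology.one ℂ (ComplexPoints (Y ⊗ Z)) := singularCohomology.map_one _
    rw [map_smul, map_smul, hone, map_smul, cupProduct_one]

/-! ### §3 The Lefschetz transfer `T` along Beauville's cover -/

section Transfer

variable {n : ℕ} {A : AbelianVariety ℂ} {K H : SchemeOver ℂ}

/-- The section `ι = (e, id) : K ⟶ A × K` of `pr_K` through the unit of `A`. -/
def unitSection (A : AbelianVariety ℂ) (K : SchemeOver ℂ) : K ⟶ A.X ⊗ K :=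
  lift (toUnit K ≫ (1 : 𝟙_ (SchemeOver ℂ) ⟶ A.X)) (𝟙 K)

/-- `pr_K ∘ ι = id`. -/
theorem unitSection_snd : unitSection A K ≫ snd A.X K = 𝟙 K := by
  simp [unitSection]

/-- `pr_A ∘ ι` is the constant map `e` (it factors through `Spec ℂ`). -/
theorem unitSection_fst : unitSection A K ≫ fst A.X K = toUnit K ≫ (1 : 𝟙_ (SchemeOver ℂ) ⟶ A.X) := by
  simp [unitSection]

/-- **`Θ ∘ ι = j`**: Beauville's cover `Θ = kummerCover act j : (a, ξ) ↦ t_a(j ξ)` restricted to `{e} × K` is the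
Kummer fibre inclusion, because the translation action is unital (`t_e^{[n+1]} = 𝟙`,
`IsTranslationAction.translateHilb_one`). -/
theorem unitSection_comp_kummerCover {N : ℕ} {Ξ : (A.X ⊗ H).left.IdealSheafData} (hH : IsHilbertSchemeOfPoints N A.X H Ξ)
    {act : A.X ⊗ H ⟶ H} (hact : IsTranslationAction Ξ act) (j : K ⟶ H) :
    unitSection A K ≫ kummerCover act j = j := by
  have h1 : j ≫ translateHilb act 1 = unitSection A K ≫ kummerCover act j := by
    simp only [translateHilb, kummerCover, unitSection, comp_lift_assoc, comp_toUnit_assoc, Category.comp_id,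
      lift_whiskerLeft_assoc, Category.id_comp]
  rw [← h1, hact.translateHilb_one hH, Category.comp_id]

/-- **THE LEFSCHETZ TRANSFER `T` (instance-free).**  For an abelian surface `A`, a Hilbert scheme `(H, Ξ)` of
`n + 1` points of `A` (smooth projective of dimension `2(n+1)`), a generalized Kummer fibre `j : K ⟶ H` (`K` smooth
projective of dimension `2n`, `n ≥ 1`) and ANY class `ℓ ∈ H²(H(ℂ); ℂ)` with a dual Lefschetz operator on `H`:
`θ*ℓ = j(ℂ)^*ℓ` has a dual Lefschetz operator on `K`.  CONDITIONAL on Beauville's IHS theorem, the Galois-cover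
fact and the Verbitsky–Looijenga–Lunts–Fujiki criterion (hypotheses). -/
theorem hasDualLefschetz_map_kummerFibre (hBe : Beauville1983_irreducibleSymplectic_of_kummerType)
    (hGal : Beauville1983_kummerCover_galois) (hV : Verbitsky1996_hasDualLefschetz_of_topPower_ne_zero)
    (hA : A.dim = 2) (hn : 1 ≤ n) (Ξ : (A.X ⊗ H).left.IdealSheafData) (𝒜 : Motives.Jacobian H)
    (x₀ : 𝟙_ (SchemeOver ℂ) ⟶ H) (j : K ⟶ H) (hHilb : IsHilbertSchemeOfPoints (n + 1) A.X H Ξ)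
    (hH : IsSmoothProjective (2 * (n + 1)) H)
    (hsq : IsPullback j (toUnit K) (lift (𝟙 H) (toUnit H ≫ x₀) ≫ 𝒜.diff) (1 : 𝟙_ (SchemeOver ℂ) ⟶ 𝒜.J.X))
    (hKs : IsSmoothProjective (2 * n) K) {ℓ : complexBetti H 2} {Λ : Module.End ℂ (totalCohomology ℂ (ComplexPoints H))}
    (hℓ : IsDualLefschetz (2 * (n + 1)) ℓ Λ) : HasDualLefschetz (2 * n) (complexBetti.map j 2 ℓ) := by
  have hS : IsSmoothProjective 2 A.X := hA ▸ AbelianVariety.isSmoothProjective_holds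
  have hK : IsGeneralizedKummerVarietyOf n A K := ⟨H, Ξ, 𝒜, x₀, j, hHilb, hH, hsq⟩
  have hI : IsProjectiveIrreducibleSymplectic (2 * n) K := hBe.generalizedKummer hn hA hK hKs
  -- `H¹(K(ℂ); ℂ) = 0`
  have h1 : ∀ w : complexBetti K 1, w = 0 := by
    haveI : SimplyConnectedSpace (ComplexPoints K) := hI.2.1
    haveI := ModuleCat.subsingleton_of_isZero
      (isZero_singularCohomology_one_of_simplyConnectedSpace (X := ComplexPoints K) ℂ)
    exact fun w ↦ Subsingleton.elim w 0
  -- the translation action and Beauville's cover `Θ`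
  set act := translationAction hHilb with hact_def
  have hact : IsTranslationAction Ξ act := isTranslationAction_translationAction hHilb
  obtain ⟨G, _, _, _, c, hc, -⟩ := hGal hA Ξ 𝒜 x₀ j act hHilb hH hsq hKs hact
  have hinj : Function.Injective
      (singularCohomology.map ℂ ℂ (Motives.AlgPoints.mapContinuous (L := ℂ) (kummerCover act j)) (2 * (2 + 2 * n))) := by
    rw [← hc]
    exact c.map_proj_injective (R := ℂ) _
  -- `ℓ^{2n+2} ≠ 0`
  have hℓpow : cupPowTwo ℓ (2 + 2 * n) ≠ 0 := by
    have h := cupPowTwo_ne_zero_of_isDualLefschetz_complexPoints hH hℓ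
    have e : 2 * (n + 1) = 2 + 2 * n := by ring
    exact e ▸ h
  -- Künneth decomposition of `Θ^*ℓ` in degree 2
  obtain ⟨a, b, hdec⟩ := exists_eq_map_fst_add_map_snd hS hKs h1 (complexBetti.map (kummerCover act j) 2 ℓ)
  -- the cover step: `b^{2n} ≠ 0`
  have hb : cupPowTwo b (2 * n) ≠ 0 :=
    cupPowTwo_ne_zero_of_add_decomposition (r := 2) (s := 2 * n) _ _ _ hinj (cupPowTwo_three_eq_zero_of_surface hS)
      hℓpow hdec
  -- `b = θ*ℓ`
  have hbj : b = complexBetti.map j 2 ℓ := by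
    have hιK : (Motives.AlgPoints.mapContinuous (L := ℂ) (snd A.X K)).comp
        (Motives.AlgPoints.mapContinuous (L := ℂ) (unitSection A K)) = ContinuousMap.id _ := by
      rw [← Motives.AlgPoints.mapContinuous_comp, unitSection_snd, Motives.AlgPoints.mapContinuous_id]
    have hιA : ∀ x : complexBetti A.X 2,
        singularCohomology.map ℂ ℂ ((Motives.AlgPoints.mapContinuous (L := ℂ) (fst A.X K)).comp
          (Motives.AlgPoints.mapContinuous (L := ℂ) (unitSection A K))) 2 x = 0 := by
      intro x
      rw [← Motives.AlgPoints.mapContinuous_comp, unitSection_fst]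
      exact complexBetti_map_two_eq_zero_of_factors_unit _ _ x
    have h := eq_map_of_add_decomposition _ _ _ _ hιK hιA hdec
    rwa [← Motives.AlgPoints.mapContinuous_comp, unitSection_comp_kummerCover hHilb hact j] at h
  exact hV n hn hI (complexBetti.map j 2 ℓ) (hbj ▸ hb)

end Transfer

/-! ### §4 Seam S3: the divisor class of a polarization -/

/-- `h ≠ 0` on `H*(A^[m](ℂ); ℂ)` for `m ≥ 1` (`H⁰ ≠ 0` and `h` acts on it by `-2m ≠ 0`); the side condition of D3. -/
theorem degreeOperator_ne_zero_hilbObj {S : SchemeOver ℂ} (H : HilbertSchemesOfPoints S) {m : ℕ} (hm : 1 ≤ m) :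
    degreeOperator ℂ (ComplexPoints (H.obj m)) (2 * m) ≠ 0 :=
  degreeOperator_ne_zero_of_ne_zero (k := 0) (N := 2 * m) (by omega)
    (singularCohomology_one_ne_zero_of_isSmoothProjective (H.smooth m))

/-- **SEAM S3 `KummerDivisorClassLefschetz`, PROVED MODULO PRINT** (the registered statement's binders verbatim).
For `n ≥ 1`, an abelian surface `A`, any choice `H` of its Hilbert schemes with ANY instance `𝔊` of the Li–Qin–Wang
interface, a Kummer fibre `j : K ⟶ A^[n+1]` (`K` smooth projective of dimension `2n`) and a polarization `α` of `A`:
`θ*(𝔊.divisorClass (n+1) α)` has a dual Lefschetz operator on `K`.  Proof: `α` has a dual `Λ_A` (hard Lefschetz on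
`A`, `IsPolarizationClass.hasDualLefschetz`); D3 (`isDualLefschetz_transferOp`, with an even Casimir tensor from
`exists_isCasimir_mem_evenTensorSpan`) makes `D_α` Lefschetz on `A^[n+1]`; then `hasDualLefschetz_map_kummerFibre`.
CONDITIONAL on the three print facts. -/
theorem hasDualLefschetz_map_divisorClass (hBe : Beauville1983_irreducibleSymplectic_of_kummerType)
    (hGal : Beauville1983_kummerCover_galois) (hV : Verbitsky1996_hasDualLefschetz_of_topPower_ne_zero)
    ⦃n : ℕ⦄ ⦃A : AbelianVariety ℂ⦄ ⦃K : SchemeOver ℂ⦄ (hA : A.dim = 2) (hn : 1 ≤ n)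
    (hS : IsSmoothProjective 2 A.X) (H : HilbertSchemesOfPoints A.X) (𝔊 : ChernCharacterOperators hS H)
    (𝒜 : Motives.Jacobian (H.obj (n + 1))) (x₀ : 𝟙_ (SchemeOver ℂ) ⟶ H.obj (n + 1)) (j : K ⟶ H.obj (n + 1))
    (hsq : IsPullback j (toUnit K) (lift (𝟙 (H.obj (n + 1))) (toUnit (H.obj (n + 1)) ≫ x₀) ≫ 𝒜.diff)
      (1 : 𝟙_ (SchemeOver ℂ) ⟶ 𝒜.J.X))
    (hKs : IsSmoothProjective (2 * n) K) (α : complexBetti A.X 2) (hα : HodgeTheory.IsPolarizationClass 2 A.X α) :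
    HasDualLefschetz (2 * n) (complexBetti.map j 2 (𝔊.divisorClass (n + 1) α)) := by
  obtain ⟨Λ_A, hΛA⟩ := HodgeTheory.IsPolarizationClass.hasDualLefschetz (n := 2) two_pos hS hα
  obtain ⟨C, hCg, hC⟩ := exists_isCasimir_mem_evenTensorSpan hS
  have hD3 := 𝔊.isDualLefschetz_transferOp hCg hC hΛA (degreeOperator_ne_zero_hilbObj H (m := n + 1) (by omega))
  exact hasDualLefschetz_map_kummerFibre hBe hGal hV hA hn (H.fam (n + 1)) 𝒜 x₀ j (H.isHilbertScheme (n + 1))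
    (H.smooth (n + 1)) hsq hKs hD3

end Summit.Ventures.HodgeKum4

end
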